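import Literature.AlgebraicGeometry.Morphisms.Devissage
import Literature.AlgebraicGeometry.Morphisms.CechH1ProjectiveCover
import Literature.AlgebraicGeometry.Morphisms.CechModuleUnit
import HarnessLib

/-!
# `cechH1_finite`: assembly of the finiteness theorem from the dévissage

`Literature.AlgebraicGeometry.Morphisms.cechH1_finite` (Görtz–Wedhorn II, Thm. 23.17 / Cor. 23.18 for
`i = 1`, `𝓕 = 𝒪_X`; The Stacks Project, Tags 02O5, 02O6) asserts: for a proper `f : X → Spec A` over a
Noetherian ring and a finite affine open covering `𝒰`, `Ȟ¹(𝒰, 𝒪_X)` is a finitely generated `A`-module.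
This file assembles it from the dévissage (`Morphisms/Devissage.devissage`, Görtz–Wedhorn I, Lemma
12.63): `X` is locally Noetherian and quasi-compact (Mathlib `LocallyOfFiniteType.isLocallyNoetherian`,
`QuasiCompact.compactSpace_of_compactSpace`); for ONE finite affine covering `𝒱` the dévissage puts
`𝒪_X` (coherent: `IsAffineLocalizing.unit`, `IsAffineFiniteType.unit`) into the class `𝒦`,
i.e. `Ȟ¹(𝒱, 𝒪_X)` is finite (`CechMH1_unit`: the module Čech group of `𝒪_X` IS `CechH1`); and the
any-covering form follows (`cechH1_finite_of_exists_affine_cover`, `Morphisms/CechH1ProjectiveCover`).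
The integral case of the dévissage (step (iii) of Lemma 12.63 together with the Chow-lemma argument
for `𝒪_Z`, `Morphisms/DevissageHeartOZ`) enters as the hypothesis `heart` of
`cechH1_finite_of_heart` (the integral step for `𝒪_Z` itself is `Morphisms/DevissageHeartOZ`).

* `cechH1_finite_of_heart` — the assembly.

Everything is proved; no named facts.

## References

* U. Görtz, T. Wedhorn, *Algebraic Geometry II* (2023): Thm. 23.17, Cor. 23.18, pp. 424–425. [GortzWedhorn2023]
* The Stacks Project, Tags 02O5, 02O6. [StacksProject]
-/

noncomputable section

open CategoryTheory AlgebraicGeometry TopologicalSpace Opposite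
open Literature.AlgebraicGeometry.Modules

universe u

namespace Literature.AlgebraicGeometry.Morphisms

/-- **`cechH1_finite` follows from the integral case of the dévissage.**
[cite: GortzWedhorn2023, Thm. 23.17 proof (pp. 424–425)] -/
theorem cechH1_finite_of_heart
    (heart : ∀ ⦃A : Type u⦄ [CommRing A] [IsNoetherianRing A] ⦃X : Scheme.{u}⦄ [IsLocallyNoetherian X]
      [CompactSpace X] (f : X ⟶ Spec (.of A)) [IsProper f] (t : Finset X.affineOpens),
      ⨆ V : t, ((V : X.affineOpens) : X.Opens) = ⊤ →
      ∀ J : X.IdealSheafData, J ≠ ⊤ → J.radical = J →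
        IsPreirreducible ((J.support : Closeds X) : Set X) →
        (∀ J' > J, ∀ M : X.Modules, Coh M → IsKilledBy J' M →
          InK f (fun V : t => ((V : X.affineOpens) : X.Opens)) M) →
        ∀ M : X.Modules, Coh M → IsKilledBy J M →
          InK f (fun V : t => ((V : X.affineOpens) : X.Opens)) M) :
    cechH1_finite.{u} := by
  apply cechH1_finite_of_exists_affine_cover
  intro A _ _ X f _
  haveI : IsLocallyNoetherian X := LocallyOfFiniteType.isLocallyNoetherian f
  haveI : CompactSpace X := QuasiCompact.compactSpace_of_compactSpace f
  obtain ⟨t, ht⟩ := exists_finite_affineOpens_iSup_eq_top (X := X)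
  refine ⟨t, fun V => ((V : X.affineOpens) : X.Opens), fun V => V.1.2, ht, ?_⟩
  have hK := devissage (f := f) (U := fun V : t => ((V : X.affineOpens) : X.Opens)) (fun V => V.1.2)
    (heart f t ht) (SheafOfModules.unit _) ⟨IsAffineLocalizing.unit, IsAffineFiniteType.unit⟩
  exact hK.finite_H1

end Literature.AlgebraicGeometry.Morphisms

end
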